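import Summits.QuantumFields.YangMills.Theorems.BalabanUVNodesN06Row17FromRow19Letters
import Literature.MathematicalPhysics.QuantumFieldTheory.Balaban1983to89.Node00.OpsYDeltaALocal
import Literature.MathematicalPhysics.QuantumFieldTheory.Balaban1983to89.B9Thm31SiteGsqBoundsReg335Y

/-!
# BalabanUVNodes ∕ N06 ([B9], `Dag.B9_main`) — THE LOCAL CLAUSE `hGsqA` («the operators G_□(U) are symmetric and positive», Thm 3.11 p. 416) AT ANY
# DIRICHLET-INVERSE INSTANCE OF THE ROW-19 LETTERS: it is print's Cor. 3.6 positivity of the padded local operator + the symmetry of the local operator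

Track A of `YM-PLAN.md` (cell `pub-ymgap`, HUMAN RULING D-0062), node **N06** = [Balaban1985BackgroundPropagators] Thms 3.1–3.15; seat `pub-ymgap-dag-n06-j`
(bundle F5, rows 15–17), g21, FILE C.  A HELPER (count-neutral, `--supports` only).

THE PRINT.  p. 416: *«Thus we have to prove the positivity of G₀. By the definition (3.87) it is enough to prove a positivity of the operators G_□.»*; pp. 408–409:
the local propagators `G_□(U)` *«constructed for the sequence {Ω_n(□)}»* — in node00-def-Y's FILE 35 letters the Dirichlet local inverse
`dirInvY P T = P·(P T P + 1 − P)⁻¹·P` of a local operator `T` at the cube projection `P = M_χ` (`χ` the indicator of the cube's bonds).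

WHAT.  `BalabanUVNodesN06Row17FromRow19Letters.row17_of_row19_letters` (this seat, p620166) derives row 17 (`hΔA`) from row 19's displayed letters plus the local
clause `hGsqA : … ∀ i, IsTransposePair ((𝔬A x).Gsq U i) ((𝔬A x).Gsq U i) ∧ ∀ v, 0 ≤ v ⬝ᵥ (𝔬A x).Gsq U i v`.  THIS FILE discharges that clause AT ANY INSTANCE
whose local propagator letters are pinned to coordinate models of Dirichlet local inverses — `Gsq U i = c • coordOpK (trBasis N) (fun _ => (dirInvY (cutMulY (χ i))
(T i U)).restrictScalars ℝ)` with `0 ≤ c` (the shape of def-Y's `GAsqY = dirInvY PB (deltaALocY …)`, FILE 40, and of the W-a walk-letter instance) — from EXACTLY: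
(i) the trace-symmetry of the local operator `T i U` (algebra at the instance) and (ii) `PosDefTr 1 (dirPadY (cutMulY (χ i)) (T i U))` — print's Cor. 3.6
positivity of the padded local operator, the analytic input (the `hloc` of this seat's g20 `B9Thm311PosViaLocalFamilyY ∕ …PosViaDeltaALocalY`).
* §1 trace-currency algebra of the Dirichlet letters: `isSymmTr_cutMulY`, `isSymmTr_sandwich`, ★ `isSymmTr_dirPadY_cutMulY`, ★ `isSymmTr_dirInvY_cutMulY`
  (n06-i `isSymmTr_ringInverse` BY NAME);
* §2 ★★ `localClause_coordOpK_dirInvY` — at the coordinate model over the trace basis: symmetry by n06-d's `isTransposePair_coordOpK_of_isSymmTr`, positive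
  semi-definiteness by n06-d's `dotProduct_coordOpK_const_eq_sum_trIP` + this seat's g20 `trIP_localInv_self_nonneg`;
* §3 ★★★ `hGsqA_of_dirichlet_pins` — the member-level clause in the shape `row17_of_row19_letters` consumes, from a pin family `hGsqPin`, the symmetry family
  `hTsymm` and the local positivity family `hloc` (regime binders as the certificate's).
* §4 the symmetry family IS A THEOREM at node00-def-Y's FILE 40 letters with a real-multiplication block projection (n06-w1 `isSymmTr_GsqY_parSymY` BY NAME):
  `isSymmTr_ClocY_parSymY`, `isSymmTr_RlocY_parSymY`, ★★ `isSymmTr_deltaALocY_parSymY` — `Δ_{a,□}(U) = Δ(U) + D_U R_□(U) D*_U + Q*aQ` is `trIP 1`-symmetric at every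
  `G`-valued `U`, `G ≤ U(N)` (this seat's g6 `B9Thm311AdjointPairs` ∕ g7 `B9Thm311Curv2Symm` algebra BY NAME); so at that instance `hGsqA` ⇐ `hloc` ALONE:
* §5 ★★★ `hGsqA_of_GAsqY_pins` — the clause for all members at pins to def-Y's `GAsqY …` from `hloc : … → ∀ i, PosDefTr 1 (padDeltaALocY …)` and nothing else;
  ★★★ `row17_of_row19_letters_GAsqY` — the end-to-end chain: row 17 ⇐ row 19's displayed schemas + the pins + Cor. 3.6 for the padded `Δ_{a,□}(U)`.
HONEST FRAMING.  Finite-dimensional linear algebra; Cor. 3.6's positivity of the padded local operators is NOT proved (it is the input `hloc`); the pin shape is a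
HYPOTHESIS (no walk-letter instance of the A-side is on record yet); COUNT-NEUTRAL; N06 NOT discharged; nothing continuum ∕ OS ∕ mass gap ∕ Clay.  0 `def`, 0 `sorry`.
-/

noncomputable section

namespace Summit.QuantumFields.YangMills.BalabanUVNodes.N06Row19LocalClauseAtDirichletInverses

open Literature.MathematicalPhysics.QuantumFieldTheory.Balaban1983to89
open Literature.MathematicalPhysics.QuantumFieldTheory.Balaban1983to89.Node00
open Literature.MathematicalPhysics.QuantumFieldTheory.Balaban1983to89.Node00.OpsYLocalInverse (dirPadY dirInvY)
open Literature.MathematicalPhysics.QuantumFieldTheory.Balaban1983to89.B9CoReadingCoords (XBK GcoK coordOpK)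
open Literature.MathematicalPhysics.QuantumFieldTheory.Balaban1983to89.B9CoReadingCoordsTranspose (TrIdx trBasis trBasis_repr_eq_trace isTransposePair_coordOpK_of_isSymmTr)
open Literature.MathematicalPhysics.QuantumFieldTheory.Balaban1983to89.B9Thm311ReadingCoords (trIP PosDefTr IsSymmTr trIP_zero_right)
open Literature.MathematicalPhysics.QuantumFieldTheory.Balaban1983to89.B9Thm311AdjointPairs (isSymmTr_sub isSymmTr_id)
open Literature.MathematicalPhysics.QuantumFieldTheory.Balaban1983to89.B9Thm311DeltaPrimeSymm (isSymmTr_add)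
open Literature.MathematicalPhysics.QuantumFieldTheory.Balaban1983to89.B9Ineq349SiteAdjoint (isSymmTr_ringInverse)
open Literature.MathematicalPhysics.QuantumFieldTheory.Balaban1983to89.B9Thm37CubeCoverCommutators (cutMulY cutMulY_apply)
open Literature.MathematicalPhysics.QuantumFieldTheory.Balaban1983to89.B9Thm311PosViaLocalInversesY (trIP_cutMulY_right_gen trIP_localInv_self_nonneg)
open Literature.MathematicalPhysics.QuantumFieldTheory.Balaban1983to89.B9Thm37Glue (IsTransposePair)
open Literature.MathematicalPhysics.QuantumFieldTheory.Balaban1983to89.B9Thm37GlueTorusCov (isTransposePair_smul)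
open Literature.MathematicalPhysics.QuantumFieldTheory.Balaban1983to89.B9Thm310Whole (Ops310 StaticOK310 Factors389 Identities310 Sizes310)
open Literature.MathematicalPhysics.QuantumFieldTheory.Balaban1983to89.B6KLevelCensusIndexV1 (KIdx)
open Literature.MathematicalPhysics.QuantumFieldTheory.Balaban1983to89.B9PinMembersKLevelV1 (MemberY geo9Y)
open Summit.QuantumFields.YangMills.BalabanUVNodes.N06SectDUnitsAtPins (dotProduct_coordOpK_const_eq_sum_trIP)
open scoped Matrix
open scoped Matrix.Norms.L2Operator

/-! ## §1 Trace-currency algebra of the Dirichlet letters -/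

section Trace

variable {X : Type} [Fintype X] {N : ℕ} {w : X → ℝ}

/-- a real multiplication operator `M_χ` is `trIP`-symmetric (any weight). [cite: Balaban1985BackgroundPropagators, p.393 (scalar products), bookkeeping] -/
theorem isSymmTr_cutMulY (χ : X → ℝ) : IsSymmTr w (cutMulY (𝔸 := Matrix (Fin N) (Fin N) ℂ) χ) :=
  fun Φ Ψ => (trIP_cutMulY_right_gen w χ Φ Ψ).symm

/-- a sandwich `M·T·M` of `trIP`-symmetric operators is `trIP`-symmetric. [cite: Balaban1985BackgroundPropagators, pp.408–409 (P_□ … P_□), bookkeeping] -/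
theorem isSymmTr_sandwich {M T : Module.End ℂ (X → Matrix (Fin N) (Fin N) ℂ)} (hM : IsSymmTr w M) (hT : IsSymmTr w T) : IsSymmTr w (M * T * M) := by
  intro Φ Ψ
  simp only [Module.End.mul_apply]
  rw [hM, hT, hM]

/-- ★ the PADDED COMPRESSION `M_χ T M_χ + (1 − M_χ)` of a `trIP`-symmetric `T` is `trIP`-symmetric. [cite: Balaban1985BackgroundPropagators, pp.408–409 (G′_□, G_□), dictionary] -/
theorem isSymmTr_dirPadY_cutMulY (χ : X → ℝ) {T : Module.End ℂ (X → Matrix (Fin N) (Fin N) ℂ)} (hT : IsSymmTr w T) :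
    IsSymmTr w (dirPadY (cutMulY χ) T) := by
  unfold dirPadY
  exact isSymmTr_add _ (isSymmTr_sandwich (isSymmTr_cutMulY χ) hT) (isSymmTr_sub (isSymmTr_id w) (isSymmTr_cutMulY χ))

/-- ★ the DIRICHLET LOCAL INVERSE `M_χ (M_χ T M_χ + 1 − M_χ)⁻¹ M_χ` of a `trIP`-symmetric `T` is `trIP`-symmetric (print: the local propagators are symmetric).
[cite: Balaban1985BackgroundPropagators, pp.408–409 (G_□), Thm 3.11 p.416 («symmetric»)] -/
theorem isSymmTr_dirInvY_cutMulY (χ : X → ℝ) {T : Module.End ℂ (X → Matrix (Fin N) (Fin N) ℂ)} (hT : IsSymmTr w T) :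
    IsSymmTr w (dirInvY (cutMulY χ) T) := by
  unfold dirInvY
  exact isSymmTr_sandwich (isSymmTr_cutMulY χ) (isSymmTr_ringInverse w (isSymmTr_dirPadY_cutMulY χ hT))

end Trace

/-! ## §2 The local clause at the coordinate model of a Dirichlet local inverse -/

section Coord

variable {X : Type} [Fintype X] {N : ℕ} {D : Type} [Fintype D]

/-- ★★ **THE LOCAL CLAUSE AT A DIRICHLET-INVERSE PIN**: for `N ≥ 1`, a `trIP 1`-symmetric local operator `T` whose padded compression `M_χ T M_χ + 1 − M_χ` is
positive definite (print's Cor. 3.6 input), and `c ≥ 0`, the scaled coordinate model `c • coordOpK (trBasis N) (fun _ => dirInvY (M_χ) T)` of the Dirichlet local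
inverse is self-transpose and positive semi-definite for the component pairing — the two conjuncts of `hGsqA`.
[cite: Balaban1985BackgroundPropagators, Thm 3.11 p.416 («positivity of the operators G_□»), Cor. 3.6 p.408, pp.408–409 (G_□)] -/
theorem localClause_coordOpK_dirInvY (χ : X → ℝ) {T : Module.End ℂ (X → Matrix (Fin N) (Fin N) ℂ)}
    (hT : IsSymmTr (fun _ => (1 : ℝ)) T) (hloc : PosDefTr (fun _ => (1 : ℝ)) (dirPadY (cutMulY χ) T)) {c : ℝ} (hc : 0 ≤ c) :
    IsTransposePair (c • coordOpK (trBasis N) (fun _ : D => (dirInvY (cutMulY χ) T).restrictScalars ℝ))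
        (c • coordOpK (trBasis N) (fun _ : D => (dirInvY (cutMulY χ) T).restrictScalars ℝ)) ∧
      ∀ v : X × D × TrIdx N × TrIdx N → ℝ, 0 ≤ v ⬝ᵥ (c • coordOpK (trBasis N) (fun _ : D => (dirInvY (cutMulY χ) T).restrictScalars ℝ)) v := by
  refine ⟨isTransposePair_smul (isTransposePair_coordOpK_of_isSymmTr (D := D) (trBasis N) (trBasis_repr_eq_trace N) _
    (isSymmTr_dirInvY_cutMulY χ hT)) c, fun v => ?_⟩
  rw [LinearMap.smul_apply, dotProduct_smul, smul_eq_mul, dotProduct_coordOpK_const_eq_sum_trIP]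
  refine mul_nonneg hc (Finset.sum_nonneg fun ν _ => Finset.sum_nonneg fun c' _ => ?_)
  simp only [LinearMap.coe_restrictScalars]
  exact trIP_localInv_self_nonneg hloc _

end Coord

/-! ## §3 ★★★ The member-level clause from Dirichlet pins, the symmetry of the local operators and their padded positivity -/

section Members

variable {N : ℕ} {d ℓ : ℕ} {hd : 1 ≤ d + 1} {hL : Odd (ℓ + 1) ∧ 1 < ℓ + 1} {b₀ b₁ : ℝ} {Mstar : ℕ}

/-- ★★★ **`hGsqA` FROM DIRICHLET PINS** — the local clause of `row17_of_row19_letters` for all members in its displayed shape, from: a pin family `hGsqPin` of the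
row-19 local propagator letters to scaled coordinate models of Dirichlet local inverses `dirInvY (cutMulY (χ x i)) (Tloc x i U)` of local operators on the fine
bonds (`0 ≤ c x`), the `trIP 1`-symmetry of the local operators on the class (`hTsymm`), and print's Cor. 3.6 positivity of their padded compressions on the class
(`hloc` — the ANALYTIC INPUT, displayed).  With def-Y FILE 40: `Tloc x i U := deltaALocY …`, `GAsqY = dirInvY PB Δ_{a,□}` at `PB = cutMulY χ`.
[cite: Balaban1985BackgroundPropagators, Thm 3.11 p.416 + Cor. 3.6 p.408 + pp.408–409 (G_□) + (3.35) p.396] -/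
theorem hGsqA_of_dirichlet_pins (bg : MemberY d ℓ hd hL b₀ b₁ Mstar → B9.Backgrounds)
    (cfg : ∀ x : MemberY d ℓ hd hL b₀ b₁ Mstar, (bg x).Cfg → CfgY (Matrix (Fin N) (Fin N) ℂ) x.toKIdx)
    {Y ι A : MemberY d ℓ hd hL b₀ b₁ Mstar → Type}
    (𝔬A : ∀ x : MemberY d ℓ hd hL b₀ b₁ Mstar, Ops310 (geo9Y x) (bg x) (XBK (TrIdx N) x.toKIdx) (Y x) (ι x) (A x))
    (χ : ∀ x : MemberY d ℓ hd hL b₀ b₁ Mstar, ι x → FBondY x.toKIdx → ℝ)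
    (Tloc : ∀ x : MemberY d ℓ hd hL b₀ b₁ Mstar, ι x → CfgY (Matrix (Fin N) (Fin N) ℂ) x.toKIdx → Module.End ℂ (FBondY x.toKIdx → Matrix (Fin N) (Fin N) ℂ))
    (c : MemberY d ℓ hd hL b₀ b₁ Mstar → ℝ) (hc : ∀ x, 0 ≤ c x) {M₁ a₁ c35 : ℝ}
    (hGsqPin : ∀ (x : MemberY d ℓ hd hL b₀ b₁ Mstar) (U : (bg x).Cfg) (i : ι x), (𝔬A x).Gsq U i =
      c x • coordOpK (trBasis N) (fun _ : Fin (d + 1) => (dirInvY (cutMulY (χ x i)) (Tloc x i (cfg x U))).restrictScalars ℝ))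
    (hTsymm : ∀ x : MemberY d ℓ hd hL b₀ b₁ Mstar, M₁ ≤ (geo9Y x).M → ∀ α₀ : ℝ, 0 < α₀ → c35 * (geo9Y x).M * α₀ ≤ a₁ →
      ∀ U : (bg x).Cfg, (bg x).Reg335 c35 α₀ U → ∀ i, IsSymmTr (fun _ => (1 : ℝ)) (Tloc x i (cfg x U)))
    (hloc : ∀ x : MemberY d ℓ hd hL b₀ b₁ Mstar, M₁ ≤ (geo9Y x).M → ∀ α₀ : ℝ, 0 < α₀ → c35 * (geo9Y x).M * α₀ ≤ a₁ →
      ∀ U : (bg x).Cfg, (bg x).Reg335 c35 α₀ U → ∀ i, PosDefTr (fun _ => (1 : ℝ)) (dirPadY (cutMulY (χ x i)) (Tloc x i (cfg x U)))) :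
    ∀ x : MemberY d ℓ hd hL b₀ b₁ Mstar, M₁ ≤ (geo9Y x).M → ∀ α₀ : ℝ, 0 < α₀ → c35 * (geo9Y x).M * α₀ ≤ a₁ →
      ∀ U : (bg x).Cfg, (bg x).Reg335 c35 α₀ U →
        ∀ i, IsTransposePair ((𝔬A x).Gsq U i) ((𝔬A x).Gsq U i) ∧ ∀ v, 0 ≤ v ⬝ᵥ (𝔬A x).Gsq U i v := by
  intro x hM α₀ hα₀ ha U hU i
  rw [hGsqPin x U i]
  exact localClause_coordOpK_dirInvY (D := Fin (d + 1)) (χ x i) (hTsymm x hM α₀ hα₀ ha U hU i) (hloc x hM α₀ hα₀ ha U hU i) (hc x)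

end Members

/-! ## §4 The symmetry of def-Y's local bond operator `Δ_{a,□}(U)` (FILE 40) — so `hTsymm` is a theorem at that instance -/

section DefY

open Literature.MathematicalPhysics.QuantumFieldTheory.Balaban1983to89.Node00.OpsYLocalInverse (GsqY)
open Literature.MathematicalPhysics.QuantumFieldTheory.Balaban1983to89.Node00.OpsYDeltaALocal (ClocY PlocY RlocY deltaALocY)
open Literature.MathematicalPhysics.QuantumFieldTheory.Balaban1983to89.B9Thm311AdjointPairs
  (isSymmTr_sandwich_of_isAdjTr isAdjTr_reverse XY_isSymmTr isAdjTr_gradY_divY coCurlY_jordanY_curlY_isSymmTr isSymmTr_QsY_aY_QY aK_isSymm)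
open Literature.MathematicalPhysics.QuantumFieldTheory.Balaban1983to89.B9Thm311SymmAtRecordV4 (symm0_parSymY adj_parSymY)
open Literature.MathematicalPhysics.QuantumFieldTheory.Balaban1983to89.B9Thm311Curv2Symm (curv2Y_isSymmTr)
open Literature.MathematicalPhysics.QuantumFieldTheory.Balaban1983to89.B9Thm31SiteGsqBoundsReg335Y (isSymmTr_GsqY_parSymY)

variable {N : ℕ} {d ℓ : ℕ} {hd : 1 ≤ d + 1} {hL : Odd (ℓ + 1) ∧ 1 < ℓ + 1} {b₀ b₁ : ℝ} (i : KIdx d ℓ hd hL b₀ b₁)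
  {G : Subgroup (Matrix (Fin N) (Fin N) ℂ)ˣ}

/-- the local inverse letter `C_□(U) = ClocY` at a real-multiplication block projection `P = M_χ` is symmetric for the block-volume pairing `wB` (the padded `Q′G′_□²Q′*`
is). [cite: Balaban1985BackgroundPropagators, pp.408–409 (C_□), (3.25) p.394; Balaban1984PropagatorsII, (2.69) p.235] -/
theorem isSymmTr_ClocY_parSymY (hG : G ≤ B7Prop2Explicit.unitaryUnits (Matrix (Fin N) (Fin N) ℂ)) {U : CfgY (Matrix (Fin N) (Fin N) ℂ) i}
    (hU : ∀ μ x, U μ x ∈ G) (D : Finset (SiteY i)) (χ : BlkY i → ℝ) :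
    IsSymmTr (B9Thm311ReadingAtLetters.wB i) (ClocY i (parSymY i) D (cutMulY χ) U) := by
  rw [OpsYDeltaALocal.ClocY_eq_dirInvY]
  exact isSymmTr_dirInvY_cutMulY χ (XY_isSymmTr i (parSymY i) (GsqY i (parSymY i) D) U (isSymmTr_GsqY_parSymY i hG hU D) (adj_parSymY i hG hU))

/-- ★ the local gauge projection `R_□(U) = I − G′_□Q′*C_□Q′G′_□` ((3.25) with the local letters) is `trIP 1`-symmetric at a real-multiplication block projection.
[cite: Balaban1985BackgroundPropagators, (3.25) p.394–395, (3.105) p.414 (P_□), pp.408–409] -/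
theorem isSymmTr_RlocY_parSymY (hG : G ≤ B7Prop2Explicit.unitaryUnits (Matrix (Fin N) (Fin N) ℂ)) {U : CfgY (Matrix (Fin N) (Fin N) ℂ) i}
    (hU : ∀ μ x, U μ x ∈ G) (D : Finset (SiteY i)) (χ : BlkY i → ℝ) :
    IsSymmTr (fun _ => (1 : ℝ)) (RlocY i (parSymY i) D (cutMulY χ) U) := by
  have hGsq := isSymmTr_GsqY_parSymY i hG hU D
  have hS : IsSymmTr (fun _ => (1 : ℝ)) (QpsY i (parSymY i) U ∘ₗ ClocY i (parSymY i) D (cutMulY χ) U ∘ₗ QpY i (parSymY i) U) :=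
    isSymmTr_sandwich_of_isAdjTr (adj_parSymY i hG hU) (isSymmTr_ClocY_parSymY i hG hU D χ)
  have hT : IsSymmTr (fun _ => (1 : ℝ))
      (GsqY i (parSymY i) D U ∘ₗ (QpsY i (parSymY i) U ∘ₗ ClocY i (parSymY i) D (cutMulY χ) U ∘ₗ QpY i (parSymY i) U) ∘ₗ GsqY i (parSymY i) D U) :=
    isSymmTr_sandwich_of_isAdjTr (Q := GsqY i (parSymY i) D U) (Qs := GsqY i (parSymY i) D U) hGsq hS
  show IsSymmTr (fun _ => (1 : ℝ)) (LinearMap.id - PlocY i (parSymY i) D (cutMulY χ) U)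
  refine isSymmTr_sub (isSymmTr_id _) ?_
  show IsSymmTr (fun _ => (1 : ℝ))
    (GsqY i (parSymY i) D U ∘ₗ QpsY i (parSymY i) U ∘ₗ ClocY i (parSymY i) D (cutMulY χ) U ∘ₗ QpY i (parSymY i) U ∘ₗ GsqY i (parSymY i) D U)
  simpa only [LinearMap.comp_assoc] using hT

/-- ★★ **def-Y's LOCAL BOND OPERATOR `Δ_{a,□}(U) = Δ(U) + D_U R_□(U) D*_U + Q*(U) a Q(U)` (FILE 40, (3.26) with `R ↦ R_□`) IS `trIP 1`-SYMMETRIC** at every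
`G`-valued `U`, `G ≤ U(N)`, for a real-multiplication block projection — the symmetry input `hTsymm` of `hGsqA_of_dirichlet_pins` at this instance (so there
`hGsqA` ⇐ the Cor. 3.6 positivity `hloc` alone). [cite: Balaban1985BackgroundPropagators, (3.26) p.395, Thm 3.11 p.416 («symmetric»), (3.8)–(3.10) p.392, (3.13) p.393] -/
theorem isSymmTr_deltaALocY_parSymY (hG : G ≤ B7Prop2Explicit.unitaryUnits (Matrix (Fin N) (Fin N) ℂ)) {U : CfgY (Matrix (Fin N) (Fin N) ℂ) i}
    (hU : ∀ μ x, U μ x ∈ G) (D : Finset (SiteY i)) (χ : BlkY i → ℝ) :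
    IsSymmTr (fun _ => (1 : ℝ)) (deltaALocY i (parSymY i) (parBY i) D (cutMulY χ) U) := by
  have hU' : ∀ μ x, ((U μ x : (Matrix (Fin N) (Fin N) ℂ)ˣ) : Matrix (Fin N) (Fin N) ℂ) ∈ unitary (Matrix (Fin N) (Fin N) ℂ) := fun μ x => hG (hU μ x)
  show IsSymmTr (fun _ => (1 : ℝ))
    (hessY i U + gradY i U ∘ₗ RlocY i (parSymY i) D (cutMulY χ) U ∘ₗ divY i U + QsY i (parBY i) U ∘ₗ aY i ∘ₗ QY i (parBY i) U)
  rw [hessY]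
  refine isSymmTr_add _ (isSymmTr_add _ (isSymmTr_add _ (coCurlY_jordanY_curlY_isSymmTr i U hU') (curv2Y_isSymmTr i U hU'))
    (isSymmTr_sandwich_of_isAdjTr (isAdjTr_reverse (isAdjTr_gradY_divY i U hU')) (isSymmTr_RlocY_parSymY i hG hU D χ))) ?_
  exact isSymmTr_QsY_aY_QY i hG (parBY i) U (fun s s' => parBY_mem i hU s s') (aK_isSymm i)

end DefY

/-! ## §5 ★★★ The clause at def-Y's FILE 40 letters `GAsqY`: from the Cor. 3.6 positivity of the padded `Δ_{a,□}(U)` ALONE -/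

section DefYMembers

open Literature.MathematicalPhysics.QuantumFieldTheory.Balaban1983to89.Node00.OpsYDeltaALocal (deltaALocY padDeltaALocY GAsqY)

variable {N : ℕ} {d ℓ : ℕ} {hd : 1 ≤ d + 1} {hL : Odd (ℓ + 1) ∧ 1 < ℓ + 1} {b₀ b₁ : ℝ} {Mstar : ℕ} {G : Subgroup (Matrix (Fin N) (Fin N) ℂ)ˣ}

/-- ★★★ **`hGsqA` AT node00-def-Y's LOCAL BOND INVERSES `GAsqY` (FILE 40), FROM THE COR. 3.6 POSITIVITY ALONE**: for `G ≤ U(N)`, a backgrounds family `bg x`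
read into def-Y's configurations by `cfg x` whose (3.35) class is `G`-valued (`hcfgG`; at the record `fun _ _ _ _ hU => hU.1.1`), and row-19 walk letters whose local
propagators are pinned to the scaled coordinate models of `GAsqY x.toKIdx (parSymY) (parBY) (Dc x i) (cutMulY (χP x i)) (cutMulY (χ x i))` (cube site sets `Dc`,
real block ∕ bond cut-offs `χP ∕ χ`, scale `0 ≤ c x`): the local clause of `row17_of_row19_letters` holds on the class as soon as
`hloc : … Reg335 … → ∀ i, PosDefTr 1 (padDeltaALocY … (cfg x U))` — print's Cor. 3.6 for the local bond operators, the ONE analytic input (symmetry is §4).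
[cite: Balaban1985BackgroundPropagators, Thm 3.11 p.416 («positivity of the operators G_□») + Cor. 3.6 p.408 + pp.408–409 + (3.26) p.395] -/
theorem hGsqA_of_GAsqY_pins (hG : G ≤ B7Prop2Explicit.unitaryUnits (Matrix (Fin N) (Fin N) ℂ))
    (bg : MemberY d ℓ hd hL b₀ b₁ Mstar → B9.Backgrounds)
    (cfg : ∀ x : MemberY d ℓ hd hL b₀ b₁ Mstar, (bg x).Cfg → CfgY (Matrix (Fin N) (Fin N) ℂ) x.toKIdx)
    {c35 : ℝ} (hcfgG : ∀ (x : MemberY d ℓ hd hL b₀ b₁ Mstar) (c α₀ : ℝ) (U : (bg x).Cfg), (bg x).Reg335 c α₀ U → ∀ μ z, cfg x U μ z ∈ G)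
    {Y ι A : MemberY d ℓ hd hL b₀ b₁ Mstar → Type}
    (𝔬A : ∀ x : MemberY d ℓ hd hL b₀ b₁ Mstar, Ops310 (geo9Y x) (bg x) (XBK (TrIdx N) x.toKIdx) (Y x) (ι x) (A x))
    (Dc : ∀ x : MemberY d ℓ hd hL b₀ b₁ Mstar, ι x → Finset (SiteY x.toKIdx))
    (χP : ∀ x : MemberY d ℓ hd hL b₀ b₁ Mstar, ι x → BlkY x.toKIdx → ℝ) (χ : ∀ x : MemberY d ℓ hd hL b₀ b₁ Mstar, ι x → FBondY x.toKIdx → ℝ)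
    (c : MemberY d ℓ hd hL b₀ b₁ Mstar → ℝ) (hc : ∀ x, 0 ≤ c x) {M₁ a₁ : ℝ}
    (hGsqPin : ∀ (x : MemberY d ℓ hd hL b₀ b₁ Mstar) (U : (bg x).Cfg) (i : ι x), (𝔬A x).Gsq U i =
      c x • coordOpK (trBasis N) (fun _ : Fin (d + 1) =>
        (GAsqY x.toKIdx (parSymY x.toKIdx) (parBY x.toKIdx) (Dc x i) (cutMulY (χP x i)) (cutMulY (χ x i)) (cfg x U)).restrictScalars ℝ))
    (hloc : ∀ x : MemberY d ℓ hd hL b₀ b₁ Mstar, M₁ ≤ (geo9Y x).M → ∀ α₀ : ℝ, 0 < α₀ → c35 * (geo9Y x).M * α₀ ≤ a₁ →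
      ∀ U : (bg x).Cfg, (bg x).Reg335 c35 α₀ U →
        ∀ i, PosDefTr (fun _ => (1 : ℝ)) (padDeltaALocY x.toKIdx (parSymY x.toKIdx) (parBY x.toKIdx) (Dc x i) (cutMulY (χP x i)) (cutMulY (χ x i)) (cfg x U))) :
    ∀ x : MemberY d ℓ hd hL b₀ b₁ Mstar, M₁ ≤ (geo9Y x).M → ∀ α₀ : ℝ, 0 < α₀ → c35 * (geo9Y x).M * α₀ ≤ a₁ →
      ∀ U : (bg x).Cfg, (bg x).Reg335 c35 α₀ U →
        ∀ i, IsTransposePair ((𝔬A x).Gsq U i) ((𝔬A x).Gsq U i) ∧ ∀ v, 0 ≤ v ⬝ᵥ (𝔬A x).Gsq U i v :=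
  hGsqA_of_dirichlet_pins bg cfg 𝔬A χ
    (fun x i V => deltaALocY x.toKIdx (parSymY x.toKIdx) (parBY x.toKIdx) (Dc x i) (cutMulY (χP x i)) V) c hc hGsqPin
    (fun x _ α₀ _ _ U hU i => isSymmTr_deltaALocY_parSymY x.toKIdx hG (hcfgG x c35 α₀ U hU) (Dc x i) (χP x i))
    (fun x hM α₀ hα₀ ha U hU i => hloc x hM α₀ hα₀ ha U hU i)

/-- ★★★ **THE END-TO-END CHAIN: ROW 17 FROM ROW 19's DISPLAYED LETTERS + COR. 3.6 FOR THE LOCAL BOND OPERATORS** — `row17_of_row19_letters` (p620166) composed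
with `hGsqA_of_GAsqY_pins`: given the row-19 schemas (`hstA`, `hIdA`, `hFacA`), the pin of `G` (`hGcoA`), a pin of the local propagator letters to def-Y's `GAsqY`
(`hGsqPin`, scale `0 ≤ c x`) and print's Cor. 3.6 positivity of the padded `Δ_{a,□}(U)` on the class (`hloc`), row 17's literal body holds for all members above
one threshold.  (Usable by the knit once the A-side walk-letter instance pins `(𝔬A x).Gsq`; until then `row17_of_row19_letters` with the displayed clause `hGsqA`.)
[cite: Balaban1985BackgroundPropagators, Thm 3.11 p.416 + (3.105) p.414 + Cor. 3.6 p.408 + (3.87), (3.89) pp.408–409; Balaban1984PropagatorsII, Lemma 2.1 (2.60)–(2.61) p.234] -/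
theorem row17_of_row19_letters_GAsqY (hN : 0 < N) (hG : G ≤ B7Prop2Explicit.unitaryUnits (Matrix (Fin N) (Fin N) ℂ))
    [∀ x : MemberY d ℓ hd hL b₀ b₁ Mstar, Fintype (geo9Y x).Site] [∀ x : MemberY d ℓ hd hL b₀ b₁ Mstar, DecidableEq (geo9Y x).Site]
    (bg : MemberY d ℓ hd hL b₀ b₁ Mstar → B9.Backgrounds) (cfg : ∀ x : MemberY d ℓ hd hL b₀ b₁ Mstar, (bg x).Cfg → CfgY (Matrix (Fin N) (Fin N) ℂ) x.toKIdx)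
    {c35 : ℝ} (hcfgG : ∀ (x : MemberY d ℓ hd hL b₀ b₁ Mstar) (c α₀ : ℝ) (U : (bg x).Cfg), (bg x).Reg335 c α₀ U → ∀ μ z, cfg x U μ z ∈ G)
    {Y ι A : MemberY d ℓ hd hL b₀ b₁ Mstar → Type} [∀ x, Fintype (ι x)] [∀ x, Fintype (A x)]
    (𝔬A : ∀ x : MemberY d ℓ hd hL b₀ b₁ Mstar, Ops310 (geo9Y x) (bg x) (XBK (TrIdx N) x.toKIdx) (Y x) (ι x) (A x))
    {Rg : MemberY d ℓ hd hL b₀ b₁ Mstar → ℝ} {H : MemberY d ℓ hd hL b₀ b₁ Mstar → Prop} {ρ Nc N' NF Cℓ θ₀ δ₀ M₁ a₁ : ℝ}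
    {κA : MemberY d ℓ hd hL b₀ b₁ Mstar → Sizes310} (hθ₀ : 0 ≤ θ₀) (hδ₀ : 0 < δ₀)
    (hstA : ∀ x, StaticOK310 (𝔬A x) ρ Nc N' NF Cℓ (κA x))
    (hIdA : ∀ x : MemberY d ℓ hd hL b₀ b₁ Mstar, M₁ ≤ (geo9Y x).M → ∀ α₀ : ℝ, 0 < α₀ → c35 * (geo9Y x).M * α₀ ≤ a₁ →
      ∀ U : (bg x).Cfg, (bg x).Reg335 c35 α₀ U → Identities310 (𝔬A x) (Rg x) (H x) U)
    (hFacA : ∀ x : MemberY d ℓ hd hL b₀ b₁ Mstar, M₁ ≤ (geo9Y x).M → ∀ α₀ : ℝ, 0 < α₀ → c35 * (geo9Y x).M * α₀ ≤ a₁ →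
      ∀ U : (bg x).Cfg, (bg x).Reg335 c35 α₀ U → Factors389 (𝔬A x) (Rg x) (H x) θ₀ δ₀ U)
    (hGcoA : ∀ (x : MemberY d ℓ hd hL b₀ b₁ Mstar) (U : (bg x).Cfg), (𝔬A x).G U =
      GcoK x.toKIdx (trBasis N) (bg x) (cfg x) (GAY x.toKIdx (parSymY x.toKIdx) (parBY x.toKIdx) (GpY x.toKIdx (parSymY x.toKIdx))) U)
    (Dc : ∀ x : MemberY d ℓ hd hL b₀ b₁ Mstar, ι x → Finset (SiteY x.toKIdx))
    (χP : ∀ x : MemberY d ℓ hd hL b₀ b₁ Mstar, ι x → BlkY x.toKIdx → ℝ) (χ : ∀ x : MemberY d ℓ hd hL b₀ b₁ Mstar, ι x → FBondY x.toKIdx → ℝ)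
    (c : MemberY d ℓ hd hL b₀ b₁ Mstar → ℝ) (hc : ∀ x, 0 ≤ c x)
    (hGsqPin : ∀ (x : MemberY d ℓ hd hL b₀ b₁ Mstar) (U : (bg x).Cfg) (i : ι x), (𝔬A x).Gsq U i =
      c x • coordOpK (trBasis N) (fun _ : Fin (d + 1) =>
        (GAsqY x.toKIdx (parSymY x.toKIdx) (parBY x.toKIdx) (Dc x i) (cutMulY (χP x i)) (cutMulY (χ x i)) (cfg x U)).restrictScalars ℝ))
    (hloc : ∀ x : MemberY d ℓ hd hL b₀ b₁ Mstar, M₁ ≤ (geo9Y x).M → ∀ α₀ : ℝ, 0 < α₀ → c35 * (geo9Y x).M * α₀ ≤ a₁ →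
      ∀ U : (bg x).Cfg, (bg x).Reg335 c35 α₀ U →
        ∀ i, PosDefTr (fun _ => (1 : ℝ)) (padDeltaALocY x.toKIdx (parSymY x.toKIdx) (parBY x.toKIdx) (Dc x i) (cutMulY (χP x i)) (cutMulY (χ x i)) (cfg x U))) :
    ∃ MR : ℝ, M₁ ≤ MR ∧ ∀ x : MemberY d ℓ hd hL b₀ b₁ Mstar, MR ≤ (geo9Y x).M → ∀ α₀ : ℝ, 0 < α₀ → c35 * (geo9Y x).M * α₀ ≤ a₁ →
      ∀ U : (bg x).Cfg, (bg x).Reg335 c35 α₀ U →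
        PosDefTr (fun _ => (1 : ℝ)) (deltaAY x.toKIdx (parSymY x.toKIdx) (parBY x.toKIdx) (GpY x.toKIdx (parSymY x.toKIdx)) (cfg x U)) :=
  N06Row17FromRow19Letters.row17_of_row19_letters hN hG bg cfg hcfgG 𝔬A hθ₀ hδ₀ hstA hIdA hFacA hGcoA
    (hGsqA_of_GAsqY_pins hG bg cfg hcfgG 𝔬A Dc χP χ c hc hGsqPin hloc)

end DefYMembers

end Summit.QuantumFields.YangMills.BalabanUVNodes.N06Row19LocalClauseAtDirichletInverses

end
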